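import Literature.Computability.QuantumComplexity.FBQPOracleAccess
import Literature.Computability.Complexity.CodeFPListKit
import Literature.Computability.Complexity.CodeFPModArith
import Literature.NumberTheory.QuadraticFields.ScholzMirrorTorsionWitnessTools
import Mathlib.Data.Nat.Squarefree
import HarnessLib

/-!
# Crux `ArithStatLadder.IqThreeMemBQP` (stmt-QuantumAdvantage-2424), line `scholz-mirror-siegel` — the guarded order-bit language (support of stub S6b)

Support file of the registered stub `stub_realWitnessOfParts` (S6b): from the class-order solver `(S5)`
(`IsQSolvable`, answers pinned only on VALID instances `⟨bin m, ⟨bin a, bin r⟩⟩`, `m ≥ 2` square-free,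
`0 < a`, `a ∣ r² − m`) towards the LANGUAGE `L₅ = VALID ∩ {3 ∣ ord [span{a, r + √m}]} ∈ BQP`, WITHOUT
juxtaposing two deciders: (1) a VALIDITY SELECTOR `hsel ∈ FP^FG` (`selector_exists`; `FG` = the factor
bit-graph language of Shor's map, `factorGraph_mem_BQP`): factor `m` through the oracle (`AdPres.batch`,
un-padding), check square-freeness on the prime-factor list (`Nat.squarefree_iff_nodup_primeFactorsList`), the
canonical re-encoding and `r² ≡ m (mod a)`, and send every invalid input to the fixed valid instance
`x₀ = ⟨bin 2, ⟨bin 1, bin 0⟩⟩` whose class is trivial (`default_not_mem_yes`); (2) the order bit of the `(S5)`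
family, read by classical post-processing (`CWrap`), is correct with probability `≥ 2/3` on valid inputs
(`exists_orderBit_family`), amplified to `9/10` by majority over `90` copies
(`PolyMajority.exists_poly_amplified`), so that the relation "on valid inputs the first output bit is the order
bit" is solved with slack `1/5` on ALL inputs (`exists_orderBit_family_slack`). The oracle pre-processing
theorem `OracleWrap.isQSolvable_of_slack` (`BQP^BQP = BQP` for search problems) then pins the membership bit
of `L₅` on every input — that last step is taken in the stub file.
-/

set_option linter.dupNamespace false -- D-0017: single-problem summit ⇒ QuantumAdvantage.QuantumAdvantage by design

noncomputable section

namespace Summit.QuantumAdvantage.QuantumAdvantage.Theorems.ArithStatLadder.IqThreeMemBQP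

open scoped NumberField nonZeroDivisors
open _root_.Computability Polynomial
open Literature.Computability.Complexity Literature.Computability.Complexity.Brick
open Literature.Computability.Complexity.CodeFP Literature.Computability.Complexity.AdQuery
open Literature.Computability.Cryptography Literature.Computability.QuantumComplexity
open Literature.NumberTheory.QuadraticFields
open Literature.Computability.Complexity.Knapsack (decNatList canonLFn canonLFn_eq canonLFn_mem_FP decNatList_encode)

/-! ### Valid instances and their models -/

/-- The triple code is injective. [folklore] -/
theorem triple_inj {m a r m' a' r' : ℕ}
    (h : boolPair (encodeNat m) (boolPair (encodeNat a) (encodeNat r)) = boolPair (encodeNat m') (boolPair (encodeNat a') (encodeNat r'))) : m = m' ∧ a = a' ∧ r = r' := by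
  have h1 := congrArg fstF h
  have h2 := congrArg (fun w => fstF (sndF w)) h
  have h3 := congrArg (fun w => sndF (sndF w)) h
  simp only [fstF_boolPair, sndF_boolPair] at h1 h2 h3
  exact ⟨by simpa using congrArg bitsToNat h1, by simpa using congrArg bitsToNat h2, by simpa using congrArg bitsToNat h3⟩

/-- `a ∣ r² − m` over `ℤ` iff `r² ≡ m (mod a)` over `ℕ`. [folklore] -/
theorem intDvd_iff_mod_eq (m a r : ℕ) : (a : ℤ) ∣ (r : ℤ) ^ 2 - m ↔ r * r % a = m % a := by
  rw [show ((r : ℤ) ^ 2 : ℤ) = ((r * r : ℕ) : ℤ) by push_cast; ring, ← Nat.modEq_iff_dvd]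
  exact ⟨fun h => h.symm, fun h => h.symm⟩

/-- **Every valid instance has a model**: a real quadratic field `F ∋ α`, `α² = m`, and the ideal
`span{a, r + α}` is nonzero. [folklore] -/
theorem exists_model {m : ℕ} (hsf : Squarefree m) (hm : 2 ≤ m) {a : ℕ} (ha : 0 < a) (r : ℕ) :
    ∃ (F : Type) (_ : Field F) (_ : NumberField F) (α : 𝓞 F), Module.finrank ℚ F = 2 ∧ (α : F) ^ 2 = (m : F) ∧
      Ideal.span {(a : 𝓞 F), (r : 𝓞 F) + α} ∈ (Ideal (𝓞 F))⁰ := by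
  obtain ⟨F, _, _, h2, hdisc⟩ := Quadratic.exists_numberField_discr_eq (Quadratic.isFundamental_fundDiscr hsf hm)
  obtain ⟨α, hα⟩ := exists_ringOfIntegers_sq_eq h2 hdisc
  exact ⟨F, inferInstance, inferInstance, α, h2, hα, span_pair_natCast_mem_nonZeroDivisors ha _⟩

/-- **Model independence of the yes-set**: on a valid instance, membership in the yes-set (`3 ∣ ord` in
EVERY model) is `3 ∣ ord` in ANY ONE model (`orderOf_mk0_span_pair_eq_of_sq_eq`). [folklore] -/
theorem mem_yes_iff {F : Type} [Field F] [NumberField F] {m a r : ℕ} {α : 𝓞 F} (hsf : Squarefree m) (hm : 2 ≤ m)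
    (h2 : Module.finrank ℚ F = 2) (hα : (α : F) ^ 2 = (m : F)) (ha : 0 < a) (hdvd : (a : ℤ) ∣ (r : ℤ) ^ 2 - m)
    (hI : Ideal.span {(a : 𝓞 F), (r : 𝓞 F) + α} ∈ (Ideal (𝓞 F))⁰) :
    boolPair (encodeNat m) (boolPair (encodeNat a) (encodeNat r)) ∈
      ({x : List Bool | ∀ (F : Type) [Field F] [NumberField F] (m a r : ℕ) (α : 𝓞 F),
      x = boolPair (encodeNat m) (boolPair (encodeNat a) (encodeNat r)) → Squarefree m → 2 ≤ m →
        Module.finrank ℚ F = 2 → (α : F) ^ 2 = (m : F) → 0 < a → (a : ℤ) ∣ (r : ℤ) ^ 2 - m →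
          ∀ hI : Ideal.span {(a : 𝓞 F), (r : 𝓞 F) + α} ∈ (Ideal (𝓞 F))⁰, 3 ∣ orderOf (ClassGroup.mk0 ⟨_, hI⟩)} : Set (List Bool)) ↔ 3 ∣ orderOf (ClassGroup.mk0 ⟨_, hI⟩) := by
  refine ⟨fun h => h F m a r α rfl hsf hm h2 hα ha hdvd hI, fun h3 F' _ _ m' a' r' α' hx hsf' hm' h2' hα' ha' hdvd' hI' => ?_⟩
  obtain ⟨rfl, rfl, rfl⟩ := triple_inj hx
  rwa [orderOf_mk0_span_pair_eq_of_sq_eq h2' h2 hsf hm hα' hα a r hI' hI]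

/-- **The default instance `x₀ = ⟨bin 2, ⟨bin 1, bin 0⟩⟩` is valid.** [folklore] -/
theorem default_mem_valid : boolPair (encodeNat 2) (boolPair (encodeNat 1) (encodeNat 0)) ∈ ({x : List Bool | ∃ m a r : ℕ, x = boolPair (encodeNat m) (boolPair (encodeNat a) (encodeNat r)) ∧ Squarefree m ∧ 2 ≤ m ∧ 0 < a ∧ (a : ℤ) ∣ (r : ℤ) ^ 2 - m} : Set (List Bool)) :=
  ⟨2, 1, 0, rfl, Nat.squarefree_two, le_rfl, Nat.one_pos, by norm_num⟩

/-- **The default instance is a no-instance**: its ideal `span{1, α}` is the unit ideal, of order `1`.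
[folklore] -/
theorem default_not_mem_yes : boolPair (encodeNat 2) (boolPair (encodeNat 1) (encodeNat 0)) ∉ ({x : List Bool | ∀ (F : Type) [Field F] [NumberField F] (m a r : ℕ) (α : 𝓞 F),
      x = boolPair (encodeNat m) (boolPair (encodeNat a) (encodeNat r)) → Squarefree m → 2 ≤ m →
        Module.finrank ℚ F = 2 → (α : F) ^ 2 = (m : F) → 0 < a → (a : ℤ) ∣ (r : ℤ) ^ 2 - m →
          ∀ hI : Ideal.span {(a : 𝓞 F), (r : 𝓞 F) + α} ∈ (Ideal (𝓞 F))⁰, 3 ∣ orderOf (ClassGroup.mk0 ⟨_, hI⟩)} : Set (List Bool)) := by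
  obtain ⟨F, _, _, α, h2, hα, hI⟩ := exists_model Nat.squarefree_two le_rfl Nat.one_pos 0
  rw [mem_yes_iff Nat.squarefree_two le_rfl h2 hα Nat.one_pos (by norm_num) hI]
  have hmem : ((1 : ℕ) : 𝓞 F) ∈ Ideal.span {((1 : ℕ) : 𝓞 F), ((0 : ℕ) : 𝓞 F) + α} :=
    Ideal.subset_span (Set.mem_insert _ _)
  have htop : Ideal.span {((1 : ℕ) : 𝓞 F), ((0 : ℕ) : 𝓞 F) + α} = ⊤ :=
    Ideal.eq_top_of_isUnit_mem _ hmem (by rw [Nat.cast_one]; exact isUnit_one)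
  have h1 : ClassGroup.mk0 ⟨_, hI⟩ = 1 := by
    rw [ClassGroup.mk0_eq_one_iff]
    rw [htop]
    exact top_isPrincipal
  rw [h1, orderOf_one]
  decide

/-! ### The validity bits -/

/-- **The validity bits, semantics**: with the prime-factor list of `m = ⟦fst x⟧`, the checks (canonical
re-encoding, `2 ≤ m`, `0 < a`, `r² ≡ m (mod a)`, no repeated prime factor) hold iff `x` is a valid instance.
[folklore] -/
theorem validBits_iff (x : List Bool) :
    (decide (x = boolPair (encodeNat (bitsToNat (fstF x))) (boolPair (encodeNat (bitsToNat (fstF (sndF x)))) (encodeNat (bitsToNat (sndF (sndF x)))))) &&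
        (decide (2 ≤ bitsToNat (fstF x)) && (decide (0 < bitsToNat (fstF (sndF x))) &&
          (decide (bitsToNat (sndF (sndF x)) * bitsToNat (sndF (sndF x)) % (bitsToNat (fstF (sndF x))) = bitsToNat (fstF x) % (bitsToNat (fstF (sndF x)))) &&
            ((bitsToNat (fstF x)).primeFactorsList).all fun q => decide (((bitsToNat (fstF x)).primeFactorsList).count q = 1))))) = true ↔
      x ∈ ({x : List Bool | ∃ m a r : ℕ, x = boolPair (encodeNat m) (boolPair (encodeNat a) (encodeNat r)) ∧ Squarefree m ∧ 2 ≤ m ∧ 0 < a ∧ (a : ℤ) ∣ (r : ℤ) ^ 2 - m} : Set (List Bool)) := by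
  simp only [Bool.and_eq_true, decide_eq_true_eq, List.all_eq_true]
  constructor
  · rintro ⟨hx, hm, ha, hmod, hall⟩
    refine ⟨_, _, _, hx, ?_, hm, ha, (intDvd_iff_mod_eq _ _ _).2 hmod⟩
    rw [Nat.squarefree_iff_nodup_primeFactorsList (by omega), List.nodup_iff_count_eq_one]
    exact fun q hq => by simpa using hall q hq
  · rintro ⟨m, a, r, rfl, hsf, hm, ha, hdvd⟩
    simp only [fstF_boolPair, sndF_boolPair, bitsToNat_encodeNat]
    refine ⟨trivial, hm, ha, (intDvd_iff_mod_eq _ _ _).1 hdvd, fun q hq => ?_⟩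
    simpa using List.count_eq_one_of_mem ((Nat.squarefree_iff_nodup_primeFactorsList (by omega)).1 hsf) hq

/-- **The validity bits on codes** (context: the input `x` and a raw list `L` of naturals).
[cite: AroraBarak2009, §1.3] -/
theorem codeFP_validBits : CodeFP (pairE strE (rawE natE)) bitE (fun t =>
    (decide (t.1 = boolPair (encodeNat (bitsToNat (fstF t.1))) (boolPair (encodeNat (bitsToNat (fstF (sndF t.1)))) (encodeNat (bitsToNat (sndF (sndF t.1)))))) &&
        (decide (2 ≤ bitsToNat (fstF t.1)) && (decide (0 < bitsToNat (fstF (sndF t.1))) &&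
          (decide (bitsToNat (sndF (sndF t.1)) * bitsToNat (sndF (sndF t.1)) % (bitsToNat (fstF (sndF t.1))) = bitsToNat (fstF t.1) % (bitsToNat (fstF (sndF t.1)))) &&
            (t.2).all fun q => decide ((t.2).count q = 1)))))) := by
  have cx : CodeFP (pairE strE (rawE natE)) strE Prod.fst := fst _ _
  have cL : CodeFP (pairE strE (rawE natE)) (rawE natE) Prod.snd := snd _ _
  have cm : CodeFP (pairE strE (rawE natE)) natE (fun t => bitsToNat (fstF t.1)) :=
    (strVal.comp (CodeFP.comp (β := List Bool) (eβ := strE) ⟨fstF, fstF_mem_FP, fun _ => rfl⟩ cx)).congr fun _ => rfl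
  have ca : CodeFP (pairE strE (rawE natE)) natE (fun t => bitsToNat (fstF (sndF t.1))) :=
    (strVal.comp (CodeFP.comp (β := List Bool) (eβ := strE)
      ⟨fstF ∘ sndF, comp_mem_FP fstF_mem_FP sndF_mem_FP, fun _ => rfl⟩ cx)).congr fun _ => rfl
  have cr : CodeFP (pairE strE (rawE natE)) natE (fun t => bitsToNat (sndF (sndF t.1))) :=
    (strVal.comp (CodeFP.comp (β := List Bool) (eβ := strE)
      ⟨sndF ∘ sndF, comp_mem_FP sndF_mem_FP sndF_mem_FP, fun _ => rfl⟩ cx)).congr fun _ => rfl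
  have cT := (cm.pair (ca.pair cr)).recodeOut (eγ := strE) fun _ => rfl
  have c1 : CodeFP (pairE strE (rawE natE)) bitE (fun t => decide (t.1 = boolPair (encodeNat (bitsToNat (fstF t.1)))
      (boolPair (encodeNat (bitsToNat (fstF (sndF t.1)))) (encodeNat (bitsToNat (sndF (sndF t.1))))))) :=
    ((eq (eα := strE) fun _ _ h => h).comp (cx.pair cT)).congr fun _ => by simp only [pairE_apply]; rfl
  have c2 : CodeFP (pairE strE (rawE natE)) bitE (fun t => decide (2 ≤ bitsToNat (fstF t.1))) :=
    (natLe.comp ((const _ 2).pair cm)).congr fun _ => rfl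
  have c3 : CodeFP (pairE strE (rawE natE)) bitE (fun t => decide (0 < bitsToNat (fstF (sndF t.1)))) :=
    (natLt.comp ((const _ 0).pair ca)).congr fun _ => rfl
  have c4 : CodeFP (pairE strE (rawE natE)) bitE (fun t => decide (bitsToNat (sndF (sndF t.1)) * bitsToNat (sndF (sndF t.1)) %
      (bitsToNat (fstF (sndF t.1))) = bitsToNat (fstF t.1) % (bitsToNat (fstF (sndF t.1))))) :=
    (natEq.comp ((natMod.comp ((natMul.comp (cr.pair cr)).pair ca)).pair (natMod.comp (cm.pair ca)))).congr fun _ => rfl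
  have cP : CodeFP (pairE (rawE natE) natE) bitE (fun t => decide (t.1.count t.2 = 1)) :=
    (natEq.comp ((rawCountNat.comp ((snd _ _).pair (fst _ _))).pair (const _ 1))).congr fun _ => rfl
  have c5 : CodeFP (pairE strE (rawE natE)) bitE (fun t => (t.2).all fun q => decide ((t.2).count q = 1)) :=
    ((all cP).comp (cL.pair cL)).congr fun _ => rfl
  exact (c1.and (c2.and (c3.and (c4.and c5)))).congr fun _ => rfl

/-- **The selector's last stage** (`FP`): `⟨x, code L⟩ ↦ x` if the validity bits hold, else `x₀`.
[cite: AroraBarak2009, §1.3] -/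
theorem selectorOut_exists : ∃ out : List Bool → List Bool, out ∈ FP ∧ ∀ (x s : List Bool),
    out (boolPair x s) = if (decide (x = boolPair (encodeNat (bitsToNat (fstF x))) (boolPair (encodeNat (bitsToNat (fstF (sndF x)))) (encodeNat (bitsToNat (sndF (sndF x)))))) &&
        (decide (2 ≤ bitsToNat (fstF x)) && (decide (0 < bitsToNat (fstF (sndF x))) &&
          (decide (bitsToNat (sndF (sndF x)) * bitsToNat (sndF (sndF x)) % (bitsToNat (fstF (sndF x))) = bitsToNat (fstF x) % (bitsToNat (fstF (sndF x)))) &&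
            (decNatList s).all fun q => decide ((decNatList s).count q = 1))))) then x
      else boolPair (encodeNat 2) (boolPair (encodeNat 1) (encodeNat 0)) := by
  have cQs : CodeFP (pairE strE strE) (rawE natE) (fun t => decNatList t.2) :=
    (rawOfList natE).comp ⟨canonLFn ∘ sndF, comp_mem_FP canonLFn_mem_FP sndF_mem_FP, fun t => by
      simp only [Function.comp_apply, pairE_apply, sndF_boolPair, canonLFn_eq]
      rw [show (encodingListNatBool.encode : List ℕ → List Bool) = listE natE from listE_eq encodingNatBool]; rfl⟩
  have cV := codeFP_validBits.comp ((fst strE strE).pair cQs)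
  obtain ⟨out, hout, hs⟩ := cV.ite (fst strE strE) (const _ (boolPair (encodeNat 2) (boolPair (encodeNat 1) (encodeNat 0))))
  refine ⟨out, hout, fun x s => ?_⟩
  have := hs (x, s)
  simp only [pairE_apply, strE, id] at this
  exact this

/-- **The selector's query maker** (`FP`): `⟨x, bin i⟩ ↦ ⟨bin ⟦fst x⟧, bin i⟩` (bit `i` of the padded code of the
prime-factor list of `m`). [cite: AroraBarak2009, §3.4] -/
theorem selectorQuery_exists : ∃ f : List Bool → List Bool, f ∈ FP ∧ ∀ (x : List Bool) (i : ℕ),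
    f (boolPair x (encodeNat i)) = boolPair (encodeNat (bitsToNat (fstF x))) (encodeNat i) := by
  have cm : CodeFP (pairE strE natE) natE (fun t => bitsToNat (fstF t.1)) :=
    (strVal.comp (CodeFP.comp (β := List Bool) (eβ := strE) ⟨fstF, fstF_mem_FP, fun _ => rfl⟩ (fst strE natE))).congr
      fun _ => rfl
  obtain ⟨f, hf, hfs⟩ := (cm.pair (snd strE natE)).recodeOut (eγ := strE) fun _ => rfl
  refine ⟨f, hf, fun x i => ?_⟩
  have := hfs (x, i)
  simp only [pairE_apply, strE, natE, id] at this
  exact this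

/-- **The validity selector** `hsel ∈ FP^FG`: `hsel x = x` on valid instances and `hsel x = x₀` otherwise —
factor `m = ⟦fst x⟧` through the factor bit-graph oracle (one batch round, un-padding) and evaluate the
validity bits. [cite: AroraBarak2009, §3.4; BBBV1997, §4] -/
theorem selector_exists : ∃ hsel : List Bool → List Bool,
    hsel ∈ FPRel (Oracle.ofLanguage {u : List Bool | ∃ (x : List Bool) (i : ℕ), u = boolPair x (encodeNat i) ∧
      ((encodingListNatBool.encode (decodeNat x).primeFactorsList).flatMap fun b => [true, b]).getD i false = true}) ∧
    (∀ x ∈ ({x : List Bool | ∃ m a r : ℕ, x = boolPair (encodeNat m) (boolPair (encodeNat a) (encodeNat r)) ∧ Squarefree m ∧ 2 ≤ m ∧ 0 < a ∧ (a : ℤ) ∣ (r : ℤ) ^ 2 - m} : Set (List Bool)), hsel x = x) ∧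
    (∀ x ∉ ({x : List Bool | ∃ m a r : ℕ, x = boolPair (encodeNat m) (boolPair (encodeNat a) (encodeNat r)) ∧ Squarefree m ∧ 2 ≤ m ∧ 0 < a ∧ (a : ℤ) ∣ (r : ℤ) ^ 2 - m} : Set (List Bool)), hsel x = boolPair (encodeNat 2) (boolPair (encodeNat 1) (encodeNat 0))) := by
  classical
  obtain ⟨f₁, hf₁, hf₁s⟩ := selectorQuery_exists
  obtain ⟨post, hpost, hposts⟩ := unpad_exists
  obtain ⟨out, hout, houts⟩ := selectorOut_exists
  set FL : Language Bool := {u : List Bool | ∃ (x : List Bool) (i : ℕ), u = boolPair x (encodeNat i) ∧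
    ((encodingListNatBool.encode (decodeNat x).primeFactorsList).flatMap (fun b => [true, b])).getD i false = true}
    with hFLdef
  have hst := ((AdPres.batch (A := FL) hf₁ (2 * (2 * (Polynomial.X + 2) ^ 2))).FP_comp hpost).FP_comp hout
  have key : ∀ x : List Bool, (out ∘ post ∘ fun x => boolPair x ((List.range ((2 * (2 * (Polynomial.X + 2) ^ 2) :
      Polynomial ℕ).eval x.length)).map fun i => FL.boolIndicator (f₁ (boolPair x (encodeNat i))))) x =
      if (decide (x = boolPair (encodeNat (bitsToNat (fstF x))) (boolPair (encodeNat (bitsToNat (fstF (sndF x)))) (encodeNat (bitsToNat (sndF (sndF x)))))) &&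
          (decide (2 ≤ bitsToNat (fstF x)) && (decide (0 < bitsToNat (fstF (sndF x))) &&
            (decide (bitsToNat (sndF (sndF x)) * bitsToNat (sndF (sndF x)) % (bitsToNat (fstF (sndF x))) = bitsToNat (fstF x) % (bitsToNat (fstF (sndF x)))) &&
              ((bitsToNat (fstF x)).primeFactorsList).all fun q => decide (((bitsToNat (fstF x)).primeFactorsList).count q = 1))))) then x
      else boolPair (encodeNat 2) (boolPair (encodeNat 1) (encodeNat 0)) := by
    intro x
    set m : ℕ := bitsToNat (fstF x) with hm
    set s := encodingListNatBool.encode m.primeFactorsList with hs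
    have hFL : ∀ i : ℕ, FL.boolIndicator (f₁ (boolPair x (encodeNat i))) = (s.flatMap fun b => [true, b]).getD i false := by
      intro i
      rw [hf₁s]
      have hiff : boolPair (encodeNat m) (encodeNat i) ∈ FL ↔ (s.flatMap fun b => [true, b]).getD i false = true := by
        constructor
        · rintro ⟨x', i', h, hb⟩
          obtain ⟨h1, h2⟩ := Prod.mk.inj (Literature.Computability.Complexity.boolPair_injective
            (show Function.uncurry boolPair (encodeNat m, encodeNat i) = Function.uncurry boolPair (x', encodeNat i') from h))
          rw [show i = i' from by simpa using congrArg decodeNat h2, hs, ← decode_encodeNat m, h1]; exact hb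
        · exact fun hb => ⟨encodeNat m, i, rfl, by rwa [decode_encodeNat]⟩
      by_cases h : boolPair (encodeNat m) (encodeNat i) ∈ FL
      · rw [(Set.mem_iff_boolIndicator _ _).1 h, eq_comm]; exact hiff.1 h
      · rw [(Set.notMem_iff_boolIndicator _ _).1 h, eq_comm, ← Bool.not_eq_true]; exact fun hb => h (hiff.2 hb)
    have hlen : (encodeNat m).length ≤ x.length := by
      rw [TM2Pass.length_encodeNat_eq_size]
      refine Nat.size_le.2 ((bitsToNat_lt _).trans_le (Nat.pow_le_pow_right two_pos ?_))
      have := length_fstF_sndF_le x; omega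
    have hmid : post (boolPair x ((List.range ((2 * (2 * (Polynomial.X + 2) ^ 2) : Polynomial ℕ).eval
        x.length)).map fun i => FL.boolIndicator (f₁ (boolPair x (encodeNat i))))) = boolPair x s := by
      rw [hposts, List.length_map, List.length_range]
      simp only [hFL]
      have hP : s.length ≤ (2 * (Polynomial.X + 2) ^ 2 : Polynomial ℕ).eval x.length := by
        have h := length_encode_primeFactorsList_le (encodeNat m)
        rw [decode_encodeNat] at h
        refine h.trans ?_
        simp only [Polynomial.eval_mul, Polynomial.eval_pow, Polynomial.eval_add, Polynomial.eval_X, Polynomial.eval_ofNat]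
        exact Nat.mul_le_mul_left 2 (Nat.pow_le_pow_left (by omega) 2)
      rw [show (2 * (2 * (Polynomial.X + 2) ^ 2) : Polynomial ℕ).eval x.length =
        2 * ((2 * (Polynomial.X + 2) ^ 2 : Polynomial ℕ).eval x.length) by simp [Polynomial.eval_mul],
        Nat.mul_div_cancel_left _ two_pos, unpad_eq s hP]
    have hqs : decNatList s = m.primeFactorsList := by rw [hs, decNatList_encode]
    simp only [Function.comp_apply]
    rw [hmid, houts, hqs]
  refine ⟨_, hst.mem_FPRel, fun x hx => ?_, fun x hx => ?_⟩
  · rw [key, if_pos ((validBits_iff x).2 hx)]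
  · rw [key, if_neg (fun h => hx ((validBits_iff x).1 h))]

end Summit.QuantumAdvantage.QuantumAdvantage.Theorems.ArithStatLadder.IqThreeMemBQP

end
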